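import Literature.AlgebraicGeometry.Motives.HodgeStructureQuotient
import Literature.AlgebraicGeometry.Motives.HodgeStructureSemisimple
import HarnessLib

/-!
# The lattice of sub-Hodge structures; a polarizable `ℚ`-Hodge structure is a finite direct sum of irreducible ones

Layer `Literature/AlgebraicGeometry/Motives` (lane `lit-hodgefound`; Layer B records «`HS^{pol}_ℚ`
is semisimple», B2-20 / B2-39 tree side), on the tree's pure `ℚ`-Hodge structures
(`HodgeStructure V n`, `SubHodgeStructure`, `SubHodgeStructure.toHodgeStructure`, `IsIrreducible`,
`Polarization`; files `Motives/HodgeStructure`, `Motives/HodgeStructureK3Type`,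
`Motives/HodgeStructureQuotient` (kernels, images, quotients as (sub-)Hodge structures),
`Motives/HodgeStructureSemisimple` (Voisin 2025 Prop. 2.11: the orthogonal of a sub-Hodge
structure for a polarization is a complementary sub-Hodge structure)). THEOREMS plus lattice
plumbing `def`s with bodies (`mapSubtype`, `comapSubtype`, `inf`, `sup`, `top`, `bot` and the
`Lattice` / `BoundedOrder` instances on `SubHodgeStructure H`); no notion is introduced, nothing
unproved is asserted (0 named facts).

## Sources, verbatim

* B. Moonen, *Families of Motives and the Mumford–Tate Conjecture*, Milan J. Math. 85 (2017),
  §2.1 (held text `paper:doi-10-1007-s00032-017-0273-x`, chunk p0003): "What matters for us is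
  that the subcategory `HS^{pol}_ℚ ⊂ HS_ℚ` of polarizable `ℚ`-Hodge structures (those which admit
  a polarization) is semisimple […] The subcategory `HS^{pol}_ℚ` is closed under direct sums,
  tensor products and duality, and every subquotient of a polarizable Hodge structure is itself
  again polarizable."
* C. Voisin, *Hodge and generalized Hodge conjectures, coniveau and algebraic cycles*, J. Open
  Math. Probl. 1 (2025), Prop. 2.11: "The category of polarizable rational Hodge structures is
  semi-simple. *Proof.* We have to show that if `H′ ⊂ H` is a Hodge substructure, where `H` is
  polarizable, then there exists a Hodge substructure `H″ ⊂ H` such that `H = H′ ⊕ H″` as Hodge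
  structures." (the tree's `SubHodgeStructure.exists_isCompl_eq_orthogonal`).
* C. Voisin, *Hodge Theory and Complex Algebraic Geometry I* (2002), §7.3.1 (held chunks
  p0147–p0148): Def. 7.22 (morphisms), Cor. 7.24 ("This filtration defines a Hodge structure on
  `Im φ`"), Lemma 7.25 (`Ker φ`), Lemma 7.26 ("`W_ℚ = V_ℚ ⊕ V'_ℚ`, where `V'_ℚ` is also a
  sub-Hodge structure of `W_ℚ`").
* D. Huybrechts, *Lectures on K3 Surfaces*, §3.3.3 (irreducible Hodge structures; the tree's
  `IsIrreducible`: "`V ≠ 0` and the only sub-Hodge structures are `0` and `V`").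

A *semisimple* abelian category is one in which every object is a (finite) direct sum of simple
objects; for the full subcategory of polarizable objects of the abelian category of `ℚ`-Hodge
structures of weight `n` (`Motives/HodgeStructureAbelianCategory`; simple = irreducible,
`HodgeStructureCat.simple_iff_isIrreducible` in `Motives/HodgeStructureFibreFunctor`) this is the
statement `exists_iSupIndep_isIrreducible` below, obtained from Prop. 2.11 by induction on the
dimension.

## Main results (namespace `Literature.AlgebraicGeometry.Motives.HodgeStructure`)

* `SubHodgeStructure.mapSubtype` / `comapSubtype` — transport of sub-Hodge structures along the
  inclusion `T ↪ H` of a sub-Hodge structure (image of `U ↪ T ↪ H`; kernel of `T ↪ H ↠ H/U`);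
  `SubHodgeStructure.inf`, `sup`, `top`, `bot` and **`Lattice (SubHodgeStructure H)`**,
  `BoundedOrder`, **`IsModularLattice`** (a sublattice of the subspaces of `V`: `toSubmodule_sup`,
  `toSubmodule_inf`, `le_iff`, `isCompl_iff_toSubmodule`), and
  **`complementedLattice_of_isPolarizable`** (Prop. 2.11 in lattice form).
* `SubHodgeStructure.isIrreducible_toHodgeStructure_iff` — `T` is irreducible as a Hodge structure
  iff `T ≠ 0` and no sub-Hodge structure of `H` lies strictly between `0` and `T`;
  **`isAtom_iff_isIrreducible`** (atoms of the lattice = irreducible sub-Hodge structures);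
  `exists_le_isIrreducible` (finite dimension: below a non-zero sub-Hodge structure there is an
  irreducible one).
* **`SubHodgeStructure.exists_finset_supIndep_isIrreducible`** — for `H` polarizable on a
  finite-dimensional `V`, every sub-Hodge structure `S` is a finite independent sum
  `S = ⨁_{U ∈ s} U` of irreducible sub-Hodge structures; **`exists_iSupIndep_isIrreducible`** /
  `exists_isInternal_isIrreducible` — `V = ⨁_{S ∈ s} S` with every `S` irreducible («`HS^{pol}_ℚ`
  is semisimple»).

Proof of the decomposition, as printed modulo Prop. 2.11: induction on `dim S`; choose an
irreducible `U₀ ⊆ S` (minimal dimension), `V = U₀ ⊕ U₀^⊥` (Prop. 2.11), hence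
`S = U₀ ⊕ (S ∩ U₀^⊥)` by modularity, and `dim (S ∩ U₀^⊥) < dim S`.

## References

* [Moonen2017FamiliesMotives] B. Moonen, Families of Motives and the Mumford–Tate Conjecture,
  Milan J. Math. 85 (2017) 257–307, §2.1.
* [Voisin2025] C. Voisin, Hodge and generalized Hodge conjectures, coniveau and algebraic cycles,
  J. Open Math. Probl. 1 (2025), Prop. 2.11.
* [VoisinHodgeI2002] C. Voisin, Hodge Theory and Complex Algebraic Geometry I, CUP 2002, §7.3.1.
* [Huybrechts2016K3] D. Huybrechts, Lectures on K3 Surfaces, CUP 2016, §3.3.3.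
-/

noncomputable section

open scoped TensorProduct

namespace Literature.AlgebraicGeometry.Motives

namespace HodgeStructure

universe u

variable {V : Type u} [AddCommGroup V] [Module ℚ V] {n : ℤ} {H : HodgeStructure V n}

/-! ### Sub-Hodge structures below a sub-Hodge structure -/

namespace SubHodgeStructure

/-- **Transport up**: a sub-Hodge structure `U` of the Hodge structure of a sub-Hodge structure `T`
of `H` is a sub-Hodge structure of `H` (the image of the composite inclusion `U ↪ T ↪ H`, a
morphism of Hodge structures). [cite: VoisinHodgeI2002, §7.3.1 Cor. 7.24] -/
def mapSubtype (T : SubHodgeStructure H) (U : SubHodgeStructure T.toHodgeStructure) :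
    SubHodgeStructure H :=
  (T.subtypeHom.comp U.subtypeHom).range

/-- Underlying subspace of `mapSubtype`: the image `T.subtype (U)`. [cite: VoisinHodgeI2002, §7.3.1 Cor. 7.24] -/
@[simp]
theorem mapSubtype_toSubmodule (T : SubHodgeStructure H) (U : SubHodgeStructure T.toHodgeStructure) :
    (T.mapSubtype U).toSubmodule = U.toSubmodule.map T.toSubmodule.subtype := by
  rw [mapSubtype, Hom.range_toSubmodule, Hom.comp_toLinearMap, subtypeHom_toLinearMap,
    subtypeHom_toLinearMap, LinearMap.range_comp, Submodule.range_subtype]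

/-- `T.subtype (U) ≤ T`. [cite: VoisinHodgeI2002, §7.3.1] -/
theorem mapSubtype_le (T : SubHodgeStructure H) (U : SubHodgeStructure T.toHodgeStructure) :
    (T.mapSubtype U).toSubmodule ≤ T.toSubmodule := by
  rw [mapSubtype_toSubmodule]
  exact Submodule.map_subtype_le _ _

/-- **Transport down**: a sub-Hodge structure `U` of `H` induces the sub-Hodge structure `U ∩ T` of
the Hodge structure of a sub-Hodge structure `T` (the kernel of the composite morphism
`T ↪ H ↠ H/U`). [cite: VoisinHodgeI2002, §7.3.1 Lemma 7.25] -/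
def comapSubtype (T U : SubHodgeStructure H) : SubHodgeStructure T.toHodgeStructure :=
  (U.mkQHom.comp T.subtypeHom).ker

/-- Underlying subspace of `comapSubtype`: the preimage `T.subtype⁻¹(U)`. [cite: VoisinHodgeI2002, §7.3.1 Lemma 7.25] -/
@[simp]
theorem comapSubtype_toSubmodule (T U : SubHodgeStructure H) :
    (T.comapSubtype U).toSubmodule = U.toSubmodule.comap T.toSubmodule.subtype := by
  rw [comapSubtype, Hom.ker_toSubmodule, Hom.comp_toLinearMap, subtypeHom_toLinearMap,
    mkQHom_toLinearMap, LinearMap.ker_comp, Submodule.ker_mkQ]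

/-- `T.subtype (T.subtype⁻¹ U) = T ⊓ U`. [cite: VoisinHodgeI2002, §7.3.1] -/
theorem mapSubtype_comapSubtype_toSubmodule (T U : SubHodgeStructure H) :
    (T.mapSubtype (T.comapSubtype U)).toSubmodule = T.toSubmodule ⊓ U.toSubmodule := by
  rw [mapSubtype_toSubmodule, comapSubtype_toSubmodule, Submodule.map_comap_subtype]

/-- **The intersection of two sub-Hodge structures is a sub-Hodge structure.**
[cite: VoisinHodgeI2002, §7.3.1 Lemma 7.25] -/
def inf (T U : SubHodgeStructure H) : SubHodgeStructure H := T.mapSubtype (T.comapSubtype U)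

/-- Underlying subspace of the intersection. [cite: VoisinHodgeI2002, §7.3.1] -/
@[simp]
theorem inf_toSubmodule (T U : SubHodgeStructure H) :
    (T.inf U).toSubmodule = T.toSubmodule ⊓ U.toSubmodule :=
  mapSubtype_comapSubtype_toSubmodule T U

/-- `V` itself as a sub-Hodge structure (the image of the identity). [cite: VoisinHodgeI2002, §7.3.1] -/
def top (H : HodgeStructure V n) : SubHodgeStructure H := (Hom.id H).range

/-- Underlying subspace of `top`. [cite: VoisinHodgeI2002, §7.3.1] -/
@[simp]
theorem top_toSubmodule (H : HodgeStructure V n) : (top H).toSubmodule = ⊤ := by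
  rw [top, Hom.range_toSubmodule]
  exact LinearMap.range_id

/-- `0` as a sub-Hodge structure (the kernel of the identity). [cite: VoisinHodgeI2002, §7.3.1] -/
def bot (H : HodgeStructure V n) : SubHodgeStructure H := (Hom.id H).ker

/-- Underlying subspace of `bot`. [cite: VoisinHodgeI2002, §7.3.1] -/
@[simp]
theorem bot_toSubmodule (H : HodgeStructure V n) : (bot H).toSubmodule = ⊥ := by
  rw [bot, Hom.ker_toSubmodule]
  exact LinearMap.ker_id

/-- **The sum of two sub-Hodge structures is a sub-Hodge structure**: `S + T` is the preimage
under `H ↠ H/S` of the image of `T` in `H/S` (kernels and images of morphisms are sub-Hodge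
structures). [cite: VoisinHodgeI2002, §7.3.1 Cor. 7.24 and Lemma 7.25] -/
def sup (S T : SubHodgeStructure H) : SubHodgeStructure H :=
  ((S.mkQHom.comp T.subtypeHom).range.mkQHom.comp S.mkQHom).ker

/-- Underlying subspace of the sum. [cite: VoisinHodgeI2002, §7.3.1] -/
@[simp]
theorem sup_toSubmodule (S T : SubHodgeStructure H) :
    (S.sup T).toSubmodule = S.toSubmodule ⊔ T.toSubmodule := by
  rw [sup, Hom.ker_toSubmodule, Hom.comp_toLinearMap, mkQHom_toLinearMap, mkQHom_toLinearMap,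
    LinearMap.ker_comp, Submodule.ker_mkQ, Hom.range_toSubmodule, Hom.comp_toLinearMap,
    mkQHom_toLinearMap, subtypeHom_toLinearMap, LinearMap.range_comp, Submodule.range_subtype,
    Submodule.comap_map_mkQ]

/-! ### The lattice of sub-Hodge structures -/

/-- `S ⊔ T := S + T`. [cite: VoisinHodgeI2002, §7.3.1] -/
instance : Max (SubHodgeStructure H) := ⟨sup⟩

/-- `S ⊓ T := S ∩ T`. [cite: VoisinHodgeI2002, §7.3.1] -/
instance : Min (SubHodgeStructure H) := ⟨inf⟩

/-- `S ≤ T` iff `S ⊆ T` as subspaces of `V`. [cite: VoisinHodgeI2002, §7.3.1] -/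
instance : LE (SubHodgeStructure H) := ⟨fun S T => S.toSubmodule ≤ T.toSubmodule⟩

/-- `S < T` iff `S ⊊ T` as subspaces of `V`. [cite: VoisinHodgeI2002, §7.3.1] -/
instance : LT (SubHodgeStructure H) := ⟨fun S T => S.toSubmodule < T.toSubmodule⟩

/-- `S ≤ T` iff `S ⊆ T` as subspaces. [cite: VoisinHodgeI2002, §7.3.1] -/
theorem le_iff {S T : SubHodgeStructure H} : S ≤ T ↔ S.toSubmodule ≤ T.toSubmodule := Iff.rfl

/-- `S < T` iff `S ⊊ T` as subspaces. [cite: VoisinHodgeI2002, §7.3.1] -/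
theorem lt_iff {S T : SubHodgeStructure H} : S < T ↔ S.toSubmodule < T.toSubmodule := Iff.rfl

/-- **Sub-Hodge structures form a lattice** (ordered by inclusion of the underlying subspaces,
with `S ⊔ T = S + T` and `S ⊓ T = S ∩ T`), a sublattice of the lattice of subspaces of `V`.
[cite: VoisinHodgeI2002, §7.3.1] -/
instance : Lattice (SubHodgeStructure H) :=
  toSubmodule_injective.lattice (fun S : SubHodgeStructure H => S.toSubmodule) Iff.rfl Iff.rfl
    (fun S T => sup_toSubmodule S T) (fun S T => inf_toSubmodule S T)

/-- Underlying subspace of `S ⊔ T`. [cite: VoisinHodgeI2002, §7.3.1] -/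
@[simp]
theorem toSubmodule_sup (S T : SubHodgeStructure H) :
    (S ⊔ T).toSubmodule = S.toSubmodule ⊔ T.toSubmodule :=
  sup_toSubmodule S T

/-- Underlying subspace of `S ⊓ T`. [cite: VoisinHodgeI2002, §7.3.1] -/
@[simp]
theorem toSubmodule_inf (S T : SubHodgeStructure H) :
    (S ⊓ T).toSubmodule = S.toSubmodule ⊓ T.toSubmodule :=
  inf_toSubmodule S T

/-- The lattice of sub-Hodge structures is bounded by `0` and `V`. [cite: VoisinHodgeI2002, §7.3.1] -/
instance : BoundedOrder (SubHodgeStructure H) where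
  top := top H
  le_top S := by rw [le_iff, top_toSubmodule]; exact le_top
  bot := bot H
  bot_le S := by rw [le_iff, bot_toSubmodule]; exact bot_le

/-- Underlying subspace of `⊤`. [cite: VoisinHodgeI2002, §7.3.1] -/
@[simp]
theorem toSubmodule_top : (⊤ : SubHodgeStructure H).toSubmodule = ⊤ := top_toSubmodule H

/-- Underlying subspace of `⊥`. [cite: VoisinHodgeI2002, §7.3.1] -/
@[simp]
theorem toSubmodule_bot : (⊥ : SubHodgeStructure H).toSubmodule = ⊥ := bot_toSubmodule H

/-- `S = ⊥` iff its subspace is `0`. [cite: VoisinHodgeI2002, §7.3.1] -/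
theorem eq_bot_iff_toSubmodule {S : SubHodgeStructure H} : S = ⊥ ↔ S.toSubmodule = ⊥ := by
  rw [← toSubmodule_bot (H := H)]
  exact ⟨fun h => by rw [h], fun h => toSubmodule_injective h⟩

/-- `S = ⊤` iff its subspace is `V`. [cite: VoisinHodgeI2002, §7.3.1] -/
theorem eq_top_iff_toSubmodule {S : SubHodgeStructure H} : S = ⊤ ↔ S.toSubmodule = ⊤ := by
  rw [← toSubmodule_top (H := H)]
  exact ⟨fun h => by rw [h], fun h => toSubmodule_injective h⟩

/-- **The lattice of sub-Hodge structures is modular** (as a sublattice of the modular lattice of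
subspaces). [cite: VoisinHodgeI2002, §7.3.1] -/
instance : IsModularLattice (SubHodgeStructure H) where
  sup_inf_le_assoc_of_le {S} T {U} h := by
    change ((S ⊔ T) ⊓ U).toSubmodule ≤ (S ⊔ T ⊓ U).toSubmodule
    rw [toSubmodule_inf, toSubmodule_sup, toSubmodule_sup, toSubmodule_inf]
    exact (sup_inf_assoc_of_le _ (le_iff.1 h)).le

/-- Disjointness of sub-Hodge structures is disjointness of the subspaces. [cite: VoisinHodgeI2002, §7.3.1] -/
theorem disjoint_iff_toSubmodule {S T : SubHodgeStructure H} :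
    Disjoint S T ↔ Disjoint S.toSubmodule T.toSubmodule := by
  rw [_root_.disjoint_iff, _root_.disjoint_iff, eq_bot_iff_toSubmodule, toSubmodule_inf]

/-- Codisjointness of sub-Hodge structures is codisjointness of the subspaces. [cite: VoisinHodgeI2002, §7.3.1] -/
theorem codisjoint_iff_toSubmodule {S T : SubHodgeStructure H} :
    Codisjoint S T ↔ Codisjoint S.toSubmodule T.toSubmodule := by
  rw [_root_.codisjoint_iff, _root_.codisjoint_iff, eq_top_iff_toSubmodule, toSubmodule_sup]

/-- Complements of sub-Hodge structures are complements of the subspaces. [cite: VoisinHodgeI2002, §7.3.1] -/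
theorem isCompl_iff_toSubmodule {S T : SubHodgeStructure H} :
    IsCompl S T ↔ IsCompl S.toSubmodule T.toSubmodule := by
  rw [_root_.isCompl_iff, _root_.isCompl_iff, disjoint_iff_toSubmodule, codisjoint_iff_toSubmodule]

/-- **For a polarizable Hodge structure the lattice of sub-Hodge structures is complemented**
(Voisin, Prop. 2.11: "if `H′ ⊂ H` is a Hodge substructure, where `H` is polarizable, then there
exists a Hodge substructure `H″ ⊂ H` such that `H = H′ ⊕ H″`"; the tree's
`SubHodgeStructure.exists_isCompl`). [cite: Voisin2025, Prop. 2.11] -/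
theorem complementedLattice_of_isPolarizable [Module.Finite ℚ V] (hH : H.IsPolarizable) :
    ComplementedLattice (SubHodgeStructure H) :=
  ⟨fun S => by
    obtain ⟨T, hT⟩ := S.exists_isCompl hH
    exact ⟨T, isCompl_iff_toSubmodule.2 hT⟩⟩

/-- **Irreducibility of a sub-Hodge structure, read inside `H`**: the Hodge structure of a sub-Hodge
structure `T` is irreducible iff `T ≠ 0` and the only sub-Hodge structures of `H` contained in `T`
are `0` and `T`. [cite: Huybrechts2016K3, §3.3.3] -/
theorem isIrreducible_toHodgeStructure_iff (T : SubHodgeStructure H) :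
    T.toHodgeStructure.IsIrreducible ↔
      T.toSubmodule ≠ ⊥ ∧ ∀ U : SubHodgeStructure H, U.toSubmodule ≤ T.toSubmodule →
        U.toSubmodule = ⊥ ∨ U.toSubmodule = T.toSubmodule := by
  constructor
  · rintro ⟨hnt, hirr⟩
    refine ⟨Submodule.nontrivial_iff_ne_bot.1 hnt, fun U hU => ?_⟩
    have hmap : (T.comapSubtype U).toSubmodule.map T.toSubmodule.subtype = U.toSubmodule := by
      rw [comapSubtype_toSubmodule, Submodule.map_comap_subtype, inf_eq_right.2 hU]
    rcases hirr (T.comapSubtype U) with h | h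
    · left
      rw [← hmap, h, Submodule.map_bot]
    · right
      rw [← hmap, h, Submodule.map_top, Submodule.range_subtype]
  · rintro ⟨hne, h⟩
    refine ⟨Submodule.nontrivial_iff_ne_bot.2 hne, fun U => ?_⟩
    have hinj : Function.Injective (Submodule.map T.toSubmodule.subtype) :=
      Submodule.map_injective_of_injective T.toSubmodule.injective_subtype
    rcases h (T.mapSubtype U) (T.mapSubtype_le U) with h0 | h1
    · left
      apply hinj
      rw [← mapSubtype_toSubmodule, h0, Submodule.map_bot]
    · right
      apply hinj
      rw [← mapSubtype_toSubmodule, h1, Submodule.map_top, Submodule.range_subtype]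

/-- **The atoms of the lattice of sub-Hodge structures are the irreducible sub-Hodge structures.**
[cite: Huybrechts2016K3, §3.3.3] -/
theorem isAtom_iff_isIrreducible (T : SubHodgeStructure H) :
    IsAtom T ↔ T.toHodgeStructure.IsIrreducible := by
  rw [isIrreducible_toHodgeStructure_iff, IsAtom, ne_eq, eq_bot_iff_toSubmodule]
  refine and_congr Iff.rfl ⟨fun h U hU => ?_, fun h U hU => ?_⟩
  · by_cases hUT : U.toSubmodule = T.toSubmodule
    · exact Or.inr hUT
    · exact Or.inl (eq_bot_iff_toSubmodule.1 (h U (lt_of_le_of_ne (le_iff.2 hU)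
        (fun hUT' => hUT (congrArg toSubmodule hUT')))))
  · rcases h U (le_iff.1 hU.le) with h0 | h1
    · exact eq_bot_iff_toSubmodule.2 h0
    · exact absurd (toSubmodule_injective h1) hU.ne

/-- **Below every non-zero sub-Hodge structure there is an irreducible one** (finite dimension:
a non-zero sub-Hodge structure of `H` inside `S` of minimal dimension is irreducible).
[cite: Huybrechts2016K3, §3.3.3] -/
theorem exists_le_isIrreducible [Module.Finite ℚ V] (S : SubHodgeStructure H)
    (hS : S.toSubmodule ≠ ⊥) :
    ∃ T : SubHodgeStructure H, T.toSubmodule ≤ S.toSubmodule ∧ T.toHodgeStructure.IsIrreducible := by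
  classical
  -- dimensions of the non-zero sub-Hodge structures inside `S`
  let P : ℕ → Prop := fun d => ∃ T : SubHodgeStructure H, T.toSubmodule ≤ S.toSubmodule ∧
    T.toSubmodule ≠ ⊥ ∧ Module.finrank ℚ T.toSubmodule = d
  have hP : ∃ d, P d := ⟨_, S, le_rfl, hS, rfl⟩
  obtain ⟨T, hTS, hT0, hTd⟩ := Nat.find_spec hP
  refine ⟨T, hTS, (isIrreducible_toHodgeStructure_iff T).2 ⟨hT0, fun U hU => ?_⟩⟩
  by_cases hU0 : U.toSubmodule = ⊥
  · exact Or.inl hU0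
  · right
    have hmin : Module.finrank ℚ T.toSubmodule ≤ Module.finrank ℚ U.toSubmodule := by
      rw [hTd]
      exact Nat.find_min' hP ⟨U, hU.trans hTS, hU0, rfl⟩
    exact Submodule.eq_of_le_of_finrank_le hU hmin

end SubHodgeStructure

/-! ### The decomposition -/

/-- **Every sub-Hodge structure of a polarizable Hodge structure is a finite direct sum of
irreducible sub-Hodge structures** (induction on the dimension: split off an irreducible
`U₀ ⊆ S`, `V = U₀ ⊕ U₀^⊥` by the semisimplicity `SubHodgeStructure.exists_isCompl_eq_orthogonal`,
and `S = U₀ ⊕ (S ∩ U₀^⊥)` by modularity). [cite: Moonen2017FamiliesMotives, §2.1 (p. 3)]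
[cite: Voisin2025, Prop. 2.11] -/
theorem SubHodgeStructure.exists_finset_supIndep_isIrreducible [Module.Finite ℚ V]
    (hH : H.IsPolarizable) (S : SubHodgeStructure H) :
    ∃ s : Finset (SubHodgeStructure H),
      s.SupIndep (fun U => U.toSubmodule) ∧ s.sup (fun U => U.toSubmodule) = S.toSubmodule ∧
        ∀ U ∈ s, U.toHodgeStructure.IsIrreducible := by
  classical
  obtain ⟨Q⟩ := hH
  -- strong induction on the dimension of `S`
  suffices h : ∀ d : ℕ, ∀ S : SubHodgeStructure H, Module.finrank ℚ S.toSubmodule ≤ d →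
      ∃ s : Finset (SubHodgeStructure H),
        s.SupIndep (fun U => U.toSubmodule) ∧ s.sup (fun U => U.toSubmodule) = S.toSubmodule ∧
          ∀ U ∈ s, U.toHodgeStructure.IsIrreducible from h _ S le_rfl
  intro d
  induction d with
  | zero =>
    intro S hS
    refine ⟨∅, Finset.supIndep_empty _, ?_, fun U hU => (Finset.notMem_empty U hU).elim⟩
    rw [Finset.sup_empty, eq_comm, ← Submodule.finrank_eq_zero]
    exact Nat.le_zero.1 hS
  | succ d ih =>
    intro S hS
    by_cases hS0 : S.toSubmodule = ⊥
    · refine ⟨∅, Finset.supIndep_empty _, ?_, fun U hU => (Finset.notMem_empty U hU).elim⟩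
      rw [Finset.sup_empty, hS0]
    obtain ⟨U₀, hU₀S, hU₀⟩ := S.exists_le_isIrreducible hS0
    have hU₀0 : U₀.toSubmodule ≠ ⊥ := ((U₀.isIrreducible_toHodgeStructure_iff).1 hU₀).1
    obtain ⟨T₀, -, hcompl⟩ := U₀.exists_isCompl_eq_orthogonal Q
    -- `S = U₀ ⊕ (S ∩ T₀)`
    set S' := S.inf T₀ with hS'
    have hsup : U₀.toSubmodule ⊔ S'.toSubmodule = S.toSubmodule := by
      rw [hS', SubHodgeStructure.inf_toSubmodule, inf_comm, ← sup_inf_assoc_of_le _ hU₀S,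
        hcompl.sup_eq_top, top_inf_eq]
    have hdisj : Disjoint U₀.toSubmodule S'.toSubmodule := by
      rw [hS', SubHodgeStructure.inf_toSubmodule]
      exact hcompl.disjoint.mono_right inf_le_right
    have hlt : Module.finrank ℚ S'.toSubmodule ≤ d := by
      have h1 := Submodule.finrank_sup_add_finrank_inf_eq U₀.toSubmodule S'.toSubmodule
      rw [hsup, hdisj.eq_bot, finrank_bot, add_zero] at h1
      have h2 : 0 < Module.finrank ℚ U₀.toSubmodule :=
        Module.finrank_pos_iff.2 (Submodule.nontrivial_iff_ne_bot.2 hU₀0)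
      omega
    obtain ⟨s', hs'ind, hs'sup, hs'irr⟩ := ih S' hlt
    refine ⟨insert U₀ s', ?_, ?_, ?_⟩
    · refine hs'ind.insert ?_
      rw [hs'sup]
      exact hdisj
    · rw [Finset.sup_insert, hs'sup, hsup]
    · intro U hU
      rcases Finset.mem_insert.1 hU with rfl | hU
      · exact hU₀
      · exact hs'irr U hU

/-- **`HS^{pol}_ℚ` is semisimple: a polarizable `ℚ`-Hodge structure on a finite-dimensional space
is an internal direct sum `V = ⨁_{S ∈ s} S` of finitely many irreducible sub-Hodge structures**
(Moonen, §2.1: "the subcategory `HS^{pol}_ℚ ⊂ HS_ℚ` of polarizable `ℚ`-Hodge structures […] is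
semisimple"; Voisin, Prop. 2.11: "The category of polarizable rational Hodge structures is
semi-simple"). [cite: Moonen2017FamiliesMotives, §2.1 (p. 3)] [cite: Voisin2025, Prop. 2.11] -/
theorem exists_iSupIndep_isIrreducible [Module.Finite ℚ V] (H : HodgeStructure V n)
    (hH : H.IsPolarizable) :
    ∃ s : Finset (SubHodgeStructure H),
      iSupIndep (fun S : s => (S : SubHodgeStructure H).toSubmodule) ∧
        (⨆ S : s, (S : SubHodgeStructure H).toSubmodule) = ⊤ ∧
          ∀ S ∈ s, S.toHodgeStructure.IsIrreducible := by
  obtain ⟨s, hind, hsup, hirr⟩ :=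
    (SubHodgeStructure.top H).exists_finset_supIndep_isIrreducible hH
  refine ⟨s, hind.independent, ?_, hirr⟩
  rw [SubHodgeStructure.top_toSubmodule, Finset.sup_eq_iSup] at hsup
  rw [← hsup, iSup_subtype]

/-- The same as an internal direct sum `V = ⨁_{S ∈ s} S` (`DirectSum.IsInternal`, which needs a
decidable index type). [cite: Moonen2017FamiliesMotives, §2.1 (p. 3)] [cite: Voisin2025, Prop. 2.11] -/
theorem exists_isInternal_isIrreducible [Module.Finite ℚ V] (H : HodgeStructure V n)
    (hH : H.IsPolarizable) :
    ∃ (s : Finset (SubHodgeStructure H)) (_ : DecidableEq s),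
      DirectSum.IsInternal (fun S : s => (S : SubHodgeStructure H).toSubmodule) ∧
        ∀ S ∈ s, S.toHodgeStructure.IsIrreducible := by
  classical
  obtain ⟨s, hind, hsup, hirr⟩ := exists_iSupIndep_isIrreducible H hH
  exact ⟨s, inferInstance, DirectSum.isInternal_submodule_of_iSupIndep_of_iSup_eq_top hind hsup,
    hirr⟩

end HodgeStructure

end Literature.AlgebraicGeometry.Motives
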